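import Summits.QuantumFields.YangMills.Theorems.BalabanUVNodesN11Sect3SupplyChain
import Summits.QuantumFields.YangMills.Theorems.BalabanUVNodesN11NoExpansionStepSpecification

/-!
# DAG node N11 — THEOREM 1 ALONG THE WITNESS CHAIN FROM THE DATA ROWS: dag-n11-d's no-expansion clause FOR A GIVEN `k`-local witness from their rows (one application of their
# witness-first face), hence Theorem 1 at a generic v1.7 parameter from, per level and FOR THE CHAIN's WITNESS ONLY, the suppliers' obligations + K0b's ∕ def-T's data rows

Cell `pub-ymgap`, YM-PLAN Track A (HUMAN RULING D-0062 ∕ D-0149), seat `pub-ymgap-dag-n11-e` (g15; R134 fan-out row N11∕s3), route `BalabanUVNodes` rev 25 (v1.7 `CoPH` key), item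
K1⁷ `StabilityBAtRecordR13SepCoPH` = stmt-QuantumFields-20542 (helper lane, count-neutral).  [III] = [Balaban1988Convergent], [IV] = [Balaban1989LargeFieldI].  Over this seat's
`…Sect3SupplyChainDefs ∕ …Sect3SupplyChain` and dag-n11-d's doors (d1)–(d3) (`…FluctTruncation`: `action23_sect2ActionDataOfRecord_congr_fluct_of_isFluctLocal`;
`…NoExpansionOldBranchGraph`: `clause_succ_CoPH_of_Omega_empty_of_pinChi_of_oldBranch_of_clause_of_graph`; `…OldBranchIntegrableOfDominated`: `integrable_oldBranch_of_dominated`;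
`…NoExpansionStepSpecification` for the row list).

WHY THIS FILE.  `…Sect3SupplyChain.formAtZS_chainWitness` takes dag-n11-d's no-expansion clause FOR THE CHAIN's WITNESS (`NoExpansionClauseFor`) as an input.  dag-n11-d's
faces are WITNESS-FIRST: for ANY `k`-local witness carrying the §2 form at `init s′`, their rows (the four pins of the general step, measurability of the residual serving `s′`,
K0b's A-fibre domination, def-T ∕ def-R's operand rows) give the clause.  The chain witness IS `k`-local when the suppliers' terms are (`isFluctLocal_chainWitness`) and carries the
form by the induction itself — so the clause input is discharged from the ROWS, and Theorem 1 reads on: the suppliers' obligations for the chain's witness + the data rows.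
§1 `noExpansionClauseFor_of_form_of_local_of_rows` — for a GIVEN `k`-local witness with the §2 form at `k`: the rows at the no-expansion histories with a PRESENT parent ⇒
   `NoExpansionClauseFor θ p k t E_k` (dag-n11-d's face, one application; absent parents by p580585's zero child).
§2 ★★★★ `sLaw₁₃CoPH_all_of_chain_of_rows` — THEOREM 1 OF [III] at a generic `θ` on the live-selector line, ALL LEVELS, from, per level `k < K` and FOR THE CHAIN's level-`k`
   WITNESS ONLY (each hypothesis may assume that witness's §2 form): the supplier's response universal in 𝐄 and `(k+1)`-local, (OE), `PresentChildObligations` at the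
   𝐓-present expansion children, and dag-n11-d's ROWS at the no-expansion histories with a present parent.  THE COMPLETE WITNESS-KEYED HAND-OVER LIST of N11.

HONEST FRAMING.  Count-neutral kernel composition; every row and obligation DISPLAYED, none discharged; nothing of Bałaban asserted; N11 NOT discharged; K1⁷ NOT closed; counts
unmoved (typed 28∕28 · discharged 5∕27).  One finite `𝕋⁴_{L^K}` programme at fixed `ε = L^{−K}`; NOT ℝ⁴, NOT OS, NOT a mass gap, NOT Clay.
Sources: [III] Theorem p.245, Thm 1 p.262, Thm 2 p.263, §3 p.279, (3.24)–(3.25) p.270, (3.16)–(3.21) pp.268–269, (2.18) p.257, (2.20)–(2.23) p.258, (2.40)–(2.42) p.261;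
[IV] (0.2)–(0.4) p.176, p.177 (i)–(ii).
-/

noncomputable section

open MeasureTheory
open scoped BigOperators ENNReal NNReal Matrix.Norms.L2Operator

namespace Summit.QuantumFields.YangMills.Theorems.BalabanUVNodesN11Sect3SupplyChainRows

open Literature.MathematicalPhysics.QuantumFieldTheory.Balaban1983to89 T4Continuum T4NestedCovariance Node00 Node00.Tk DagBinding
open B15DeterminingSets
open BalabanUVNodesN11FluctTruncationDefs

open BalabanUVNodesN11NoExpansionOldBranchGraph (clause_succ_CoPH_of_Omega_empty_of_pinChi_of_oldBranch_of_clause_of_graph)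
open BalabanUVNodesN11OldBranchIntegrableOfDominated (integrable_oldBranch_of_dominated)
open BalabanUVNodesN11Sect3SupplyPresentParents (slotsTOfRecord₁₃H_succ_eq_zero_of_init_eq_zero)
open BalabanUVNodesN11Sect3SupplyChainDefs
open BalabanUVNodesN11Sect3SupplyChain (formAtZS_chainWitness)

variable {F : T4Family} {N : ℕ} [NeZero N]
variable (θ : Stage13HParams F N) (p : B12.RunParams)

/-! ## §1  dag-n11-d's no-expansion clause for a GIVEN `k`-local witness from their rows -/

/-- **THE NO-EXPANSION 𝐓-CLAUSE FOR A GIVEN `k`-LOCAL WITNESS `(t, E_k)` OF `ρ_k`'s §2 FORM, FROM dag-n11-d's ROWS** (one application of their witness-first face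
`…NoExpansionOldBranchGraph.clause_succ_CoPH_of_Omega_empty_of_pinChi_of_oldBranch_of_clause_of_graph` with the old-branch integrability from `…OldBranchIntegrableOfDominated`,
exactly as in their `…NoExpansionStepSpecification`, but for THE GIVEN witness instead of one they choose): at every no-expansion history `s′` with a PRESENT parent the
rows — (P) prefix agreement, (V) the generation-`k` pin, `quad_k(∅) = 0`, `k`-locality of `quad_j(Λ_{j+1})`, measurability of `ζ0 ∕ quad` of `θ.zhAt p s′`, per old branch
K0b's A-fibre domination and the operand measurability ∕ bound FOR THIS WITNESS — give the clause; absent parents by p580585.  Core provisos, `ZhUnity`, `k < K`, `1 ≤ M`.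
[cite: Balaban1988Convergent, Theorem p.245, (3.24)–(3.25) p.270, (3.1) p.264, (2.18) p.257, (2.20)–(2.23) p.258, (3.16)–(3.21) pp.268–269; Balaban1989LargeFieldI, (0.2)–(0.3) p.176] -/
theorem noExpansionClauseFor_of_form_of_local_of_rows (h : θ.Provisos₁₃CoPH F N) (hU : θ.ZhUnity F N) {k : ℕ} (hk : k < p.K) (hM : 1 ≤ θ.τ9.M)
    (t : SeqOfRecord F θ.ν θ.τ9.M (gOfRecord₁₃ F N θ.toStage13Params p) p.K k → Sect2.TermValues (F.P p.K) (MatA N) (FluctV N) θ.τ9.M) (Ek : SeqOfRecord F θ.ν θ.τ9.M (gOfRecord₁₃ F N θ.toStage13Params p) p.K k → ℝ)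
    (hform : HasSect2FormAtZS F N (FluctV N) p.K (settingOfRecord₁₃ F N θ.toStage13Params p) k (θ.rzAt p) (WtOfRecord₁₃H F N θ p) (UbgOfRecord₁₃CoP F N θ.toStage13Params p k)
      (fun s u => Sect2.LawsRT (sect2TowerOfRecord F N (FluctV N) p.K (settingOfRecord₁₃ F N θ.toStage13Params p) (θ.rzAt p s) s u) (settingOfRecord₁₃ F N θ.toStage13Params p).lf k)
      (slotsOfRecord F N θ.ν θ.τ9 (EOfRecord₁₃ F N θ.toStage13Params) (wOfRecord₉ F N θ.toStage9Params) θ.ppSel p (gOfRecord₁₃ F N θ.toStage13Params p) k) t Ek)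
    (hloc : ∀ s₀, IsFluctLocal k (t s₀))
    (hrows : ∀ s : SeqOfRecord F θ.ν θ.τ9.M (gOfRecord₁₃ F N θ.toStage13Params p) p.K (k + 1), s.Ω (k + 1) = ∅ →
        slotsOfRecord F N θ.ν θ.τ9 (EOfRecord₁₃ F N θ.toStage13Params) (wOfRecord₉ F N θ.toStage9Params) θ.ppSel p (gOfRecord₁₃ F N θ.toStage13Params p) k s.init ≠ 0 →
        -- the four pins of the general step: (P), (V), `quad_k(∅) = 0`, `k`-locality of `quad_j(Λ_{j+1})`
        (∀ j, j < k → (θ.zhAt p s).ζ0 j = (θ.zhAt p s.init).ζ0 j ∧ (θ.zhAt p s).quad j = (θ.zhAt p s.init).quad j) ∧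
        (∀ (V' : GaugeField (F.P p.K) (k + 1) (SU N)) (U₀ : GaugeField (F.P p.K) k (SU N)),
          (θ.zhAt p s).ζ0 k Set.univ (pairCfgAt (V := FluctV N) k V' U₀) =
            chiSeqOfRecord F N θ.ν θ.τ9.M (gOfRecord₁₃ F N θ.toStage13Params p) p.K k s.init U₀ *
              wOfRecord₉ F N θ.toStage9Params p (gOfRecord₁₃ F N θ.toStage13Params p) k s U₀ ((avOfRecord F N p.K k).avg U₀)) ∧
        (∀ (V' : GaugeField (F.P p.K) (k + 1) (SU N)) (U₀ : GaugeField (F.P p.K) k (SU N)), (θ.zhAt p s).quad k ∅ (pairCfgAt (V := FluctV N) k V' U₀) = 0) ∧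
        (∀ j, j < k → ∀ ω ω' : MultiCfg (F.P p.K) (SU N) (FluctV N), (∀ i, i ≤ k → ω i = ω' i) →
          (θ.zhAt p s).quad j (s.init.Λ (j + 1)) ω = (θ.zhAt p s).quad j (s.init.Λ (j + 1)) ω') ∧
        -- measurability of the residual serving `s′`
        (∀ j (Y : Set (Site (F.P p.K) 0)), Measurable ((θ.zhAt p s).ζ0 j Y)) ∧
        (∀ j (Λ' : Set (Site (F.P p.K) 0)), Measurable ((θ.zhAt p s).quad j Λ')) ∧
        -- per old branch: A-fibre domination (K0b) and the operand rows (def-T ∕ def-R)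
        (∀ S ∈ admSOfRecord F θ.ν θ.τ9.M (gOfRecord₁₃ F N θ.toStage13Params p) p.K k s.init, ∀ j : ℕ,
          ∃ ŵ : (↥(Set.toFinite (B10Eq42TorusConstraint.bondsIn j ((s.init.Λ (j + 1))ᶜ ∩ s.init.Ω (j + 1)))).toFinset → FluctV N) → ℝ≥0∞, Measurable ŵ ∧
            (∫⁻ a, ŵ a ∂(Measure.pi fun _ : ↥(Set.toFinite (B10Eq42TorusConstraint.bondsIn j ((s.init.Λ (j + 1))ᶜ ∩ s.init.Ω (j + 1)))).toFinset => (volume : Measure (FluctV N)))) ≠ ⊤ ∧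
            ∀ ω, ENNReal.ofReal ((WtOfRecord₁₃H F N θ p s).w j (s.init.Λ (j + 1)) ((s.init.Λ (j + 1))ᶜ ∩ s.init.Ω (j + 1)) (S (j + 1)) ω) ≤
              ŵ (fun b : ↥(Set.toFinite (B10Eq42TorusConstraint.bondsIn j ((s.init.Λ (j + 1))ᶜ ∩ s.init.Ω (j + 1)))).toFinset => (ω j).2 b)) ∧
        (∀ S ∈ admSOfRecord F θ.ν θ.τ9.M (gOfRecord₁₃ F N θ.toStage13Params p) p.K k s.init,
          Measurable (fun ω : MultiCfg (F.P p.K) (SU N) (FluctV N) =>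
            sect2Operand F N (FluctV N) p.K (settingOfRecord₁₃ F N θ.toStage13Params p) (θ.rzAt p s.init) s.init (t s.init) (Ek s.init)
                (UbgOfRecord₁₃CoP F N θ.toStage13Params p k s.init) (S, fun j => (ω j).2) (fun j => (ω j).1)) ∧
          ∃ CΦ : ℝ, ∀ a U, sect2Operand F N (FluctV N) p.K (settingOfRecord₁₃ F N θ.toStage13Params p) (θ.rzAt p s.init) s.init (t s.init) (Ek s.init)
                (UbgOfRecord₁₃CoP F N θ.toStage13Params p k s.init) a U ≤ CΦ)) :
    NoExpansionClauseFor θ p k t Ek := by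
  intro s hΩ
  by_cases h0 : slotsOfRecord F N θ.ν θ.τ9 (EOfRecord₁₃ F N θ.toStage13Params) (wOfRecord₉ F N θ.toStage9Params) θ.ppSel p (gOfRecord₁₃ F N θ.toStage13Params p) k s.init = 0
  · exact Or.inl (slotsTOfRecord₁₃H_succ_eq_zero_of_init_eq_zero θ p s h0)
  obtain ⟨hpre, hZ, hq, hqloc, hζm, hqm, hW, hΦ⟩ := hrows s hΩ h0
  refine clause_succ_CoPH_of_Omega_empty_of_pinChi_of_oldBranch_of_clause_of_graph θ p h hk hM s hΩ hqloc hpre (t s.init) (Ek s.init)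
    (fun S a a' Uf ha => action23_sect2ActionDataOfRecord_congr_fluct_of_isFluctLocal p.K _ _ s.init (hloc s.init) (Ek s.init) S a a' ha Uf)
    (hform.2 s.init).2 hZ hq fun S hSm => ?_
  choose ŵ hŵm hŵfin hdom using hW S hSm
  obtain ⟨hΦm, CΦ, hΦle⟩ := hΦ S hSm
  exact integrable_oldBranch_of_dominated θ p h.zhLaws hU s S hζm hqm ŵ hŵm
    (fun j => (∫⁻ a, ŵ j a ∂(Measure.pi fun _ : ↥(Set.toFinite (B10Eq42TorusConstraint.bondsIn j ((s.init.Λ (j + 1))ᶜ ∩ s.init.Ω (j + 1)))).toFinset => (volume : Measure (FluctV N)))).toNNReal)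
    (fun j => le_of_eq (ENNReal.coe_toNNReal (hŵfin j)).symm) hdom
    (Φ := sect2Operand F N (FluctV N) p.K (settingOfRecord₁₃ F N θ.toStage13Params p) (θ.rzAt p s.init) s.init (t s.init) (Ek s.init)
                (UbgOfRecord₁₃CoP F N θ.toStage13Params p k s.init)) hΦm (fun a U => (sect2Operand_pos p.K _ _ s.init (t s.init) (Ek s.init) _ a U).le) CΦ hΦle

/-! ## §2  Theorem 1 along the witness chain from the suppliers' obligations and the data rows -/

/-- **★★★★ THEOREM 1 OF [III] AT A GENERIC v1.7 PARAMETER `θ`, ALL LEVELS, ALL HISTORIES — `∀ k ≤ K, SLaw₁₃CoPH θ p k` — FROM, PER LEVEL `k < K` AND FOR THE CHAIN's level-`k`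
WITNESS ONLY (each hypothesis may assume that witness's §2 form — the inductive hypothesis): the supplier's response universal in 𝐄 and `(k+1)`-local in the fluctuation variables;
(OE) the four 𝐄-clauses; `PresentChildObligations` at the 𝐓-present expansion children ((O1′) the supplier's `𝐁^{(k)}`, (O2) Thm 2's clauses, (O3′) the 𝐓-image identity); and
dag-n11-d's ROWS (the four pins of the general step, measurability of the residual, K0b's A-fibre domination, def-T ∕ def-R's operand rows FOR THE CHAIN's WITNESS) at the
no-expansion histories with a present parent.**  On the live-selector line: core provisos (row `rstep`), `ZhUnity`, selector clause, admissibility, `0 ≤ κ, E₀, B₀`, `1 ≤ M`.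
THE COMPLETE WITNESS-KEYED HAND-OVER LIST OF N11: §1 discharges `NoExpansionClauseFor` inside `…Sect3SupplyChain.formAtZS_chainWitness` (the chain is `k`-local by
`isFluctLocal_chainWitness`).  Everything DISPLAYED; nothing of Bałaban asserted.
[cite: Balaban1988Convergent, Thm 1 p.262, Theorem p.245, Thm 2 p.263, §3 p.279, (3.24)–(3.25) p.270, (3.16)–(3.21) pp.268–269; Balaban1989LargeFieldI, (0.2)–(0.4) p.176, p.177 (i)–(ii)] -/
theorem sLaw₁₃CoPH_all_of_chain_of_rows (h : θ.Provisos₁₃CoPH F N) (hU : θ.ZhUnity F N)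
    (hsel : θ.ppSel = ppSelLiveOfRecord F N θ.ν θ.τ9 (EOfRecord₁₃ F N θ.toStage13Params) (wOfRecord₉ F N θ.toStage9Params))
    (hθ : θ.Admissible F N) (hκ : 0 ≤ θ.s2.lf.κ) (hE₀ : 0 ≤ θ.s2.lf.E₀) (hB₀ : 0 ≤ θ.s2.lf.B₀) (hM : 1 ≤ θ.τ9.M) (σ : Sect3Supplier θ p)
    (hσloc : ∀ k (s : SeqOfRecord F θ.ν θ.τ9.M (gOfRecord₁₃ F N θ.toStage13Params p) p.K (k + 1)), IsFluctLocal (k + 1) ((σ k (chainWitness θ p σ k).1 (chainWitness θ p σ k).2).1 s))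
    (huN : ∀ k, k < p.K → HasSect2FormAtZS F N (FluctV N) p.K (settingOfRecord₁₃ F N θ.toStage13Params p) k (θ.rzAt p) (WtOfRecord₁₃H F N θ p) (UbgOfRecord₁₃CoP F N θ.toStage13Params p k)
        (fun s u => Sect2.LawsRT (sect2TowerOfRecord F N (FluctV N) p.K (settingOfRecord₁₃ F N θ.toStage13Params p) (θ.rzAt p s) s u) (settingOfRecord₁₃ F N θ.toStage13Params p).lf k)
        (slotsOfRecord F N θ.ν θ.τ9 (EOfRecord₁₃ F N θ.toStage13Params) (wOfRecord₉ F N θ.toStage9Params) θ.ppSel p (gOfRecord₁₃ F N θ.toStage13Params p) k) (chainWitness θ p σ k).1 (chainWitness θ p σ k).2 →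
      Sect2.UniversalE (σ k (chainWitness θ p σ k).1 (chainWitness θ p σ k).2).1)
    (hOE : ∀ k, k < p.K → HasSect2FormAtZS F N (FluctV N) p.K (settingOfRecord₁₃ F N θ.toStage13Params p) k (θ.rzAt p) (WtOfRecord₁₃H F N θ p) (UbgOfRecord₁₃CoP F N θ.toStage13Params p k)
        (fun s u => Sect2.LawsRT (sect2TowerOfRecord F N (FluctV N) p.K (settingOfRecord₁₃ F N θ.toStage13Params p) (θ.rzAt p s) s u) (settingOfRecord₁₃ F N θ.toStage13Params p).lf k)
        (slotsOfRecord F N θ.ν θ.τ9 (EOfRecord₁₃ F N θ.toStage13Params) (wOfRecord₉ F N θ.toStage9Params) θ.ppSel p (gOfRecord₁₃ F N θ.toStage13Params p) k) (chainWitness θ p σ k).1 (chainWitness θ p σ k).2 →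
      ∀ s : SeqOfRecord F θ.ν θ.τ9.M (gOfRecord₁₃ F N θ.toStage13Params p) p.K (k + 1), NewEClausesAt θ p k ((σ k (chainWitness θ p σ k).1 (chainWitness θ p σ k).2).1 s) s)
    (hpres : ∀ k, k < p.K → HasSect2FormAtZS F N (FluctV N) p.K (settingOfRecord₁₃ F N θ.toStage13Params p) k (θ.rzAt p) (WtOfRecord₁₃H F N θ p) (UbgOfRecord₁₃CoP F N θ.toStage13Params p k)
        (fun s u => Sect2.LawsRT (sect2TowerOfRecord F N (FluctV N) p.K (settingOfRecord₁₃ F N θ.toStage13Params p) (θ.rzAt p s) s u) (settingOfRecord₁₃ F N θ.toStage13Params p).lf k)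
        (slotsOfRecord F N θ.ν θ.τ9 (EOfRecord₁₃ F N θ.toStage13Params) (wOfRecord₉ F N θ.toStage9Params) θ.ppSel p (gOfRecord₁₃ F N θ.toStage13Params p) k) (chainWitness θ p σ k).1 (chainWitness θ p σ k).2 →
      ∀ s : SeqOfRecord F θ.ν θ.τ9.M (gOfRecord₁₃ F N θ.toStage13Params p) p.K (k + 1), s.Ω (k + 1) ≠ ∅ → slotsTOfRecord F N θ.ν θ.τ9 (EOfRecord₁₃ F N θ.toStage13Params) (wOfRecord₉ F N θ.toStage9Params) θ.ppSel p (gOfRecord₁₃ F N θ.toStage13Params p) (k + 1) s ≠ 0 →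
      PresentChildObligations θ p k (chainWitness θ p σ k).1 (σ k (chainWitness θ p σ k).1 (chainWitness θ p σ k).2).1
        (σ k (chainWitness θ p σ k).1 (chainWitness θ p σ k).2).2 s)
    (hrows : ∀ k, k < p.K → HasSect2FormAtZS F N (FluctV N) p.K (settingOfRecord₁₃ F N θ.toStage13Params p) k (θ.rzAt p) (WtOfRecord₁₃H F N θ p) (UbgOfRecord₁₃CoP F N θ.toStage13Params p k)
        (fun s u => Sect2.LawsRT (sect2TowerOfRecord F N (FluctV N) p.K (settingOfRecord₁₃ F N θ.toStage13Params p) (θ.rzAt p s) s u) (settingOfRecord₁₃ F N θ.toStage13Params p).lf k)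
        (slotsOfRecord F N θ.ν θ.τ9 (EOfRecord₁₃ F N θ.toStage13Params) (wOfRecord₉ F N θ.toStage9Params) θ.ppSel p (gOfRecord₁₃ F N θ.toStage13Params p) k) (chainWitness θ p σ k).1 (chainWitness θ p σ k).2 →
      ∀ s : SeqOfRecord F θ.ν θ.τ9.M (gOfRecord₁₃ F N θ.toStage13Params p) p.K (k + 1), s.Ω (k + 1) = ∅ →
        slotsOfRecord F N θ.ν θ.τ9 (EOfRecord₁₃ F N θ.toStage13Params) (wOfRecord₉ F N θ.toStage9Params) θ.ppSel p (gOfRecord₁₃ F N θ.toStage13Params p) k s.init ≠ 0 →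
        -- the four pins of the general step: (P), (V), `quad_k(∅) = 0`, `k`-locality of `quad_j(Λ_{j+1})`
        (∀ j, j < k → (θ.zhAt p s).ζ0 j = (θ.zhAt p s.init).ζ0 j ∧ (θ.zhAt p s).quad j = (θ.zhAt p s.init).quad j) ∧
        (∀ (V' : GaugeField (F.P p.K) (k + 1) (SU N)) (U₀ : GaugeField (F.P p.K) k (SU N)),
          (θ.zhAt p s).ζ0 k Set.univ (pairCfgAt (V := FluctV N) k V' U₀) =
            chiSeqOfRecord F N θ.ν θ.τ9.M (gOfRecord₁₃ F N θ.toStage13Params p) p.K k s.init U₀ *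
              wOfRecord₉ F N θ.toStage9Params p (gOfRecord₁₃ F N θ.toStage13Params p) k s U₀ ((avOfRecord F N p.K k).avg U₀)) ∧
        (∀ (V' : GaugeField (F.P p.K) (k + 1) (SU N)) (U₀ : GaugeField (F.P p.K) k (SU N)), (θ.zhAt p s).quad k ∅ (pairCfgAt (V := FluctV N) k V' U₀) = 0) ∧
        (∀ j, j < k → ∀ ω ω' : MultiCfg (F.P p.K) (SU N) (FluctV N), (∀ i, i ≤ k → ω i = ω' i) →
          (θ.zhAt p s).quad j (s.init.Λ (j + 1)) ω = (θ.zhAt p s).quad j (s.init.Λ (j + 1)) ω') ∧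
        -- measurability of the residual serving `s′`
        (∀ j (Y : Set (Site (F.P p.K) 0)), Measurable ((θ.zhAt p s).ζ0 j Y)) ∧
        (∀ j (Λ' : Set (Site (F.P p.K) 0)), Measurable ((θ.zhAt p s).quad j Λ')) ∧
        -- per old branch: A-fibre domination (K0b) and the operand rows (def-T ∕ def-R)
        (∀ S ∈ admSOfRecord F θ.ν θ.τ9.M (gOfRecord₁₃ F N θ.toStage13Params p) p.K k s.init, ∀ j : ℕ,
          ∃ ŵ : (↥(Set.toFinite (B10Eq42TorusConstraint.bondsIn j ((s.init.Λ (j + 1))ᶜ ∩ s.init.Ω (j + 1)))).toFinset → FluctV N) → ℝ≥0∞, Measurable ŵ ∧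
            (∫⁻ a, ŵ a ∂(Measure.pi fun _ : ↥(Set.toFinite (B10Eq42TorusConstraint.bondsIn j ((s.init.Λ (j + 1))ᶜ ∩ s.init.Ω (j + 1)))).toFinset => (volume : Measure (FluctV N)))) ≠ ⊤ ∧
            ∀ ω, ENNReal.ofReal ((WtOfRecord₁₃H F N θ p s).w j (s.init.Λ (j + 1)) ((s.init.Λ (j + 1))ᶜ ∩ s.init.Ω (j + 1)) (S (j + 1)) ω) ≤
              ŵ (fun b : ↥(Set.toFinite (B10Eq42TorusConstraint.bondsIn j ((s.init.Λ (j + 1))ᶜ ∩ s.init.Ω (j + 1)))).toFinset => (ω j).2 b)) ∧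
        (∀ S ∈ admSOfRecord F θ.ν θ.τ9.M (gOfRecord₁₃ F N θ.toStage13Params p) p.K k s.init,
          Measurable (fun ω : MultiCfg (F.P p.K) (SU N) (FluctV N) =>
            sect2Operand F N (FluctV N) p.K (settingOfRecord₁₃ F N θ.toStage13Params p) (θ.rzAt p s.init) s.init ((chainWitness θ p σ k).1 s.init) ((chainWitness θ p σ k).2 s.init)
                (UbgOfRecord₁₃CoP F N θ.toStage13Params p k s.init) (S, fun j => (ω j).2) (fun j => (ω j).1)) ∧
          ∃ CΦ : ℝ, ∀ a U, sect2Operand F N (FluctV N) p.K (settingOfRecord₁₃ F N θ.toStage13Params p) (θ.rzAt p s.init) s.init ((chainWitness θ p σ k).1 s.init) ((chainWitness θ p σ k).2 s.init)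
                (UbgOfRecord₁₃CoP F N θ.toStage13Params p k s.init) a U ≤ CΦ)) :
    ∀ k, k ≤ p.K → SLaw₁₃CoPH F N θ p k := fun k hk =>
  (sLaw₁₃CoPH_iff F N θ p k).mpr ⟨_, _, formAtZS_chainWitness θ p h hsel hθ hκ hE₀ hB₀ hM σ huN hOE hpres
    (fun k' hk' hform => noExpansionClauseFor_of_form_of_local_of_rows θ p h hU hk' hM _ _ hform
      (fun s₀ => isFluctLocal_chainWitness θ p σ hσloc k' s₀) (hrows k' hk' hform)) k hk⟩

end Summit.QuantumFields.YangMills.Theorems.BalabanUVNodesN11Sect3SupplyChainRows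

end
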